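import Literature.NumberTheory.GaloisRepresentations.ContinuousCohomologyNineTerm
import Mathlib.GroupTheory.QuotientGroup.Finite
import HarnessLib

/-!
# Two-out-of-three finiteness along the nine-term sequence `H⁰ → H¹ → H²`, the short exact
# sequence of invariants, and the Euler-characteristic form of the nine-term count

Topic `NumberTheory/GaloisRepresentations`; namespace `Literature.NumberTheory.GaloisRepresentations`.
THEOREMS ONLY (no definition, no named fact, no `sorry`, no instance; D-0026).  Sequel of
`ContinuousCohomologyConnecting.lean` (the connecting maps `IsSES.δ₀`, `IsSES.δ₁` and the six
exactness statements of Serre, *Cohomologie galoisienne*, I §2.2, in element form) and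
`ContinuousCohomologyNineTerm.lean` (`IsSES.card_nineTerm`, the count
`#M₁^Γ·#M₃^Γ·#H¹(M₂)·#H²(M₁)·#H²(M₃) = #M₂^Γ·#H¹(M₁)·#H¹(M₃)·#H²(M₂)` — "both sides are additive in
`M`", Milne, *Arithmetic Duality Theorems*, I §2, proof of Thm. 2.8, and I §5, Lemma 5.3: "`φ(M)`
… is multiplicative in short exact sequences").

For a short exact sequence `0 → M₁ →(f) M₂ →(g) M₃ → 0` of discrete modules (`IsSES f g`) over a
locally compact group `Γ`:

* §1 **finiteness propagates along the nine-term sequence** ("if two of three consecutive terms of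
  an exact sequence are finite, so is the third", Milne I §2, the sentence before (2.8): "We know
  … that the groups … are finite"): `IsSES.finite_one_X₂`, `finite_two_X₂` (middle terms),
  `finite_one_X₁`, `finite_two_X₁` (left terms, through `δ₀`, `δ₁`), `finite_one_X₃` (through
  `δ₁`), `finite_two_X₃` (when `H³(Γ, M₁) = 0`, `H²(g)` is onto); and `natCard_X₂ : #M₂ = #M₁·#M₃`.
  These are the bookkeeping steps of every dévissage "`0 → M′ → M → M″ → 0`, induction on `#M`"
  (Serre II §5.2–5.4, Milne I 2.8 / 5.1, Neukirch–Schmidt–Wingberg (8.3.20)).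
* §2 **the invariants of a short exact sequence under a normal subgroup `N ⊴ Γ` acting trivially on
  `M₂`** form a short exact sequence of discrete `Γ ⧸ N`-modules
  (`IsSES.invariantsHom`; the passage `Γ_K ↦ G_{K,S} = Γ_K ⧸ N_S` for modules unramified outside
  `S`, Harari Def. 15.36 / Remark 17.7 (b): a `G_S`-module "is" a `Γ_K`-module on which
  `Gal(K̄/K_S)` acts trivially).
* §3 **the Euler-characteristic form of the nine-term count**: with
  `χ_r(M) = #M^Γ · #H²(Γ, M) · #M^r / #H¹(Γ, M)` (any exponent `r : ℕ`; `r = r₂(K)` is Tate's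
  normalisation at a totally complex number field, Milne I Thm. 5.1), cleared of denominators,
  `χ_r(M₂)·#H¹(M₁)·#H¹(M₃) = #H¹(M₂)·χ_r(M₁)·χ_r(M₃)` (`IsSES.card_nineTerm_euler`), i.e. Milne's
  Lemma 5.3 "`φ` is multiplicative" granted `H³(Γ, M₁) = 0` (at a totally complex number field this
  is `cd_p G_S ≤ 2`; the sibling `GaloisCohomology/RestrictedRamificationEulerCharacteristicSES`
  supplies it).

## References
* J.-P. Serre, *Cohomologie galoisienne* / *Galois Cohomology* (1997), I §2.2 (long exact
  sequence), I §2.6 (the `G/H`-module `A^H`), II §5.4. [SerreGaloisCohomology1997]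
* J. S. Milne, *Arithmetic Duality Theorems*, 2nd ed. (2006), I §2 Thm. 2.8 (proof), I §5
  Lemma 5.3 (p. 69). [MilneADT2006]
* D. Harari, *Galois Cohomology and Class Field Theory* (2020), Def. 15.36, Remark 17.7 (b).
  [Harari2020]
-/

noncomputable section

open CategoryTheory Function

universe u

namespace Literature.NumberTheory.GaloisRepresentations

open _root_.TopRep _root_.ContRepresentation _root_.ContinuousCohomology

/-! ### §0. Counting helper: the middle of an exact triple with finite ends is finite -/

section Counting

/-- **The middle term of an exact `α → β → γ` with `α`, `γ` finite is finite** (`ker ψ ⊆ im φ`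
suffices; Mathlib's `AddGroup.fintypeOfKerLeRange`). [folklore] -/
private theorem finite_of_ker_le_range {α β γ : Type*} [AddCommGroup α] [AddCommGroup β] [AddCommGroup γ]
    [Finite α] [Finite γ] (φ : α →+ β) (ψ : β →+ γ) (h : ∀ b, ψ b = 0 → ∃ a, φ a = b) :
    Finite β := by
  haveI := Fintype.ofFinite α
  haveI := Fintype.ofFinite γ
  haveI : Fintype β := AddGroup.fintypeOfKerLeRange φ ψ fun b hb => by
    obtain ⟨a, ha⟩ := h b ((AddMonoidHom.mem_ker).1 hb)
    exact ⟨a, ha⟩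
  exact Finite.of_fintype β

end Counting

/-! ### §1. Two-out-of-three finiteness along `0 → M₁^Γ → ⋯ → H²(Γ, M₃)` -/

section NineTerm

variable {A : Type*} [CommRing A] [TopologicalSpace A]
variable {Γ : Type u} [Group Γ] [TopologicalSpace Γ] [IsTopologicalGroup Γ] [LocallyCompactSpace Γ]
variable {M₁ : Type u} [AddCommGroup M₁] [Module A M₁] [TopologicalSpace M₁] [DiscreteTopology M₁]
  [ContinuousSMul A M₁]
variable {M₂ : Type u} [AddCommGroup M₂] [Module A M₂] [TopologicalSpace M₂] [DiscreteTopology M₂]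
  [ContinuousSMul A M₂]
variable {M₃ : Type u} [AddCommGroup M₃] [Module A M₃] [TopologicalSpace M₃] [DiscreteTopology M₃]
  [ContinuousSMul A M₃]
variable {ρ₁ : ContinuousRep Γ A M₁} {ρ₂ : ContinuousRep Γ A M₂} {ρ₃ : ContinuousRep Γ A M₃}
variable {f : ρ₁.toTopRep ⟶ ρ₂.toTopRep} {g : ρ₂.toTopRep ⟶ ρ₃.toTopRep}

namespace IsSES

omit [IsTopologicalGroup Γ] [LocallyCompactSpace Γ] in
/-- **`#M₂ = #M₁ · #M₃`** for a short exact sequence `0 → M₁ → M₂ → M₃ → 0` (of the underlying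
abelian groups; "`[M]` is multiplicative", the order side of Milne's additivity argument).
[cite: MilneADT2006, I §2 Thm. 2.8 (proof)] -/
theorem natCard_X₂ (h : IsSES f g) : Nat.card M₂ = Nat.card M₁ * Nat.card M₃ := by
  let φ : M₁ →+ M₂ := f.hom.toLinearMap.toAddMonoidHom
  let ψ : M₂ →+ M₃ := g.hom.toLinearMap.toAddMonoidHom
  have hker : ψ.ker = φ.range := by
    ext y
    rw [AddMonoidHom.mem_ker, AddMonoidHom.mem_range]
    exact ⟨fun hy => h.exact_mid y hy, by rintro ⟨x, rfl⟩; exact h.g_f_apply x⟩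
  rw [AddSubgroup.card_eq_card_quotient_mul_card_addSubgroup ψ.ker,
    Nat.card_congr (QuotientAddGroup.quotientKerEquivOfSurjective ψ h.surjective).toEquiv, hker,
    Nat.card_congr (AddMonoidHom.ofInjective (f := φ) h.injective).toEquiv.symm, mul_comm]

omit [LocallyCompactSpace Γ] in
/-- **`H¹(Γ, M₂)` is finite if `H¹(Γ, M₁)` and `H¹(Γ, M₃)` are** (exactness of
`H¹(M₁) → H¹(M₂) → H¹(M₃)`). [cite: SerreGaloisCohomology1997, I §2.2] -/
theorem finite_one_X₂ (h : IsSES f g) [Finite (continuousCohomology 1 ρ₁.toTopRep)]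
    [Finite (continuousCohomology 1 ρ₃.toTopRep)] : Finite (continuousCohomology 1 ρ₂.toTopRep) :=
  finite_of_ker_le_range (cohomologyMap f 1).hom.toLinearMap.toAddMonoidHom
    (cohomologyMap g 1).hom.toLinearMap.toAddMonoidHom
    fun y hy => h.exists_map_one_eq_of_map_one_eq_zero y hy

/-- **`H²(Γ, M₂)` is finite if `H²(Γ, M₁)` and `H²(Γ, M₃)` are** (exactness of
`H²(M₁) → H²(M₂) → H²(M₃)`). [cite: SerreGaloisCohomology1997, I §2.2] -/
theorem finite_two_X₂ (h : IsSES f g) [Finite (continuousCohomology 2 ρ₁.toTopRep)]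
    [Finite (continuousCohomology 2 ρ₃.toTopRep)] : Finite (continuousCohomology 2 ρ₂.toTopRep) :=
  finite_of_ker_le_range (cohomologyMap f 2).hom.toLinearMap.toAddMonoidHom
    (cohomologyMap g 2).hom.toLinearMap.toAddMonoidHom
    fun w hw => h.exists_map_two_eq_of_map_two_eq_zero w hw

omit [LocallyCompactSpace Γ] in
/-- **`H¹(Γ, M₁)` is finite if `M₃^Γ` and `H¹(Γ, M₂)` are** (exactness of
`M₃^Γ →δ₀ H¹(M₁) → H¹(M₂)`; `M₃^Γ` is finite as soon as `M₃` is).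
[cite: SerreGaloisCohomology1997, I §2.2] -/
theorem finite_one_X₁ (h : IsSES f g) [Finite ρ₃.toTopRep.ρ.invariants]
    [Finite (continuousCohomology 1 ρ₂.toTopRep)] : Finite (continuousCohomology 1 ρ₁.toTopRep) :=
  finite_of_ker_le_range h.δ₀.toAddMonoidHom (cohomologyMap f 1).hom.toLinearMap.toAddMonoidHom
    fun x hx => h.exists_δ₀_eq_of_map_one_eq_zero x hx

/-- **`H¹(Γ, M₃)` is finite if `H¹(Γ, M₂)` and `H²(Γ, M₁)` are** (exactness of
`H¹(M₂) → H¹(M₃) →δ₁ H²(M₁)`). [cite: SerreGaloisCohomology1997, I §2.2] -/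
theorem finite_one_X₃ (h : IsSES f g) [Finite (continuousCohomology 1 ρ₂.toTopRep)]
    [Finite (continuousCohomology 2 ρ₁.toTopRep)] : Finite (continuousCohomology 1 ρ₃.toTopRep) :=
  finite_of_ker_le_range (cohomologyMap g 1).hom.toLinearMap.toAddMonoidHom h.δ₁.toAddMonoidHom
    fun x hx => h.exists_map_one_eq_of_δ₁_eq_zero x hx

/-- **`H²(Γ, M₁)` is finite if `H¹(Γ, M₃)` and `H²(Γ, M₂)` are** (exactness of
`H¹(M₃) →δ₁ H²(M₁) → H²(M₂)`). [cite: SerreGaloisCohomology1997, I §2.2] -/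
theorem finite_two_X₁ (h : IsSES f g) [Finite (continuousCohomology 1 ρ₃.toTopRep)]
    [Finite (continuousCohomology 2 ρ₂.toTopRep)] : Finite (continuousCohomology 2 ρ₁.toTopRep) :=
  finite_of_ker_le_range h.δ₁.toAddMonoidHom (cohomologyMap f 2).hom.toLinearMap.toAddMonoidHom
    fun z hz => h.exists_δ₁_eq_of_map_two_eq_zero z hz

/-- **`H²(Γ, M₃)` is finite if `H²(Γ, M₂)` is and `H³(Γ, M₁) = 0`** (`H²(g)` is then onto,
`IsSES.map_two_surjective_of_subsingleton_three`). [cite: SerreGaloisCohomology1997, I §2.2] -/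
theorem finite_two_X₃ (h : IsSES f g) [Subsingleton (continuousCohomology 3 ρ₁.toTopRep)]
    [Finite (continuousCohomology 2 ρ₂.toTopRep)] : Finite (continuousCohomology 2 ρ₃.toTopRep) :=
  Finite.of_surjective _ h.map_two_surjective_of_subsingleton_three

/-- **All of `H¹(Γ, Mᵢ)`, `H²(Γ, Mᵢ)` (`i = 1, 2, 3`) are finite as soon as `M₃`, `H¹(Γ, M₂)`,
`H²(Γ, M₂)` are finite, `H³(Γ, M₁) = 0` and ONE of `H¹(Γ, M₃)`, `H²(Γ, M₁)` is finite** — here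
with `H²(Γ, M₁)` finite (the shape met when `M₁` is a line `ℤ/p` with known cohomology and `M₂` is
the module under induction). [cite: SerreGaloisCohomology1997, I §2.2] [cite: MilneADT2006, I §2 Thm. 2.8 (proof)] -/
theorem finite_one_two_of_X₂_of_two_X₁ (h : IsSES f g) [Finite M₃]
    [Finite (continuousCohomology 1 ρ₂.toTopRep)] [Finite (continuousCohomology 2 ρ₂.toTopRep)]
    [Finite (continuousCohomology 2 ρ₁.toTopRep)]
    [Subsingleton (continuousCohomology 3 ρ₁.toTopRep)] :
    Finite (continuousCohomology 1 ρ₁.toTopRep) ∧ Finite (continuousCohomology 1 ρ₃.toTopRep) ∧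
      Finite (continuousCohomology 2 ρ₃.toTopRep) :=
  ⟨h.finite_one_X₁, h.finite_one_X₃, h.finite_two_X₃⟩

end IsSES

end NineTerm

/-! ### §2. Invariants of a short exact sequence under a normal subgroup acting trivially -/

section Invariants

variable {A : Type*} [CommRing A] [TopologicalSpace A]
variable {Γ : Type u} [Group Γ] [TopologicalSpace Γ] [IsTopologicalGroup Γ]
variable {N : Subgroup Γ} [N.Normal]
variable {M₁ : Type u} [AddCommGroup M₁] [Module A M₁] [TopologicalSpace M₁] [DiscreteTopology M₁]
  [ContinuousSMul A M₁]
variable {M₂ : Type u} [AddCommGroup M₂] [Module A M₂] [TopologicalSpace M₂] [DiscreteTopology M₂]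
  [ContinuousSMul A M₂]
variable {M₃ : Type u} [AddCommGroup M₃] [Module A M₃] [TopologicalSpace M₃] [DiscreteTopology M₃]
  [ContinuousSMul A M₃]
variable {ρ₁ : ContinuousRep Γ A M₁} {ρ₂ : ContinuousRep Γ A M₂} {ρ₃ : ContinuousRep Γ A M₃}
variable {f : ρ₁.toTopRep ⟶ ρ₂.toTopRep} {g : ρ₂.toTopRep ⟶ ρ₃.toTopRep}

namespace IsSES

omit [IsTopologicalGroup Γ] [N.Normal] in
/-- If `N` acts trivially on the middle term `M₂` of a short exact sequence, it acts trivially on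
`M₁`. [cite: SerreGaloisCohomology1997, I §2.6] -/
theorem apply_eq_X₁_of_X₂ (h : IsSES f g) (hN : ∀ n ∈ N, ∀ y : M₂, ρ₂ n y = y) (n : Γ)
    (hn : n ∈ N) (x : M₁) : ρ₁ n x = x :=
  h.injective (by rw [ContinuousRep.hom_comm_apply f n x, hN n hn])

omit [IsTopologicalGroup Γ] [N.Normal] in
/-- If `N` acts trivially on the middle term `M₂` of a short exact sequence, it acts trivially on
`M₃`. [cite: SerreGaloisCohomology1997, I §2.6] -/
theorem apply_eq_X₃_of_X₂ (h : IsSES f g) (hN : ∀ n ∈ N, ∀ y : M₂, ρ₂ n y = y) (n : Γ)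
    (hn : n ∈ N) (v : M₃) : ρ₃ n v = v := by
  obtain ⟨y, rfl⟩ := h.surjective v
  rw [← ContinuousRep.hom_comm_apply g n y, hN n hn]

omit [IsTopologicalGroup Γ] [N.Normal] in
/-- The invariants `Mᵢ^N` are everything when `N` acts trivially on `M₂`: for `M₁`.
[cite: SerreGaloisCohomology1997, I §2.6] -/
theorem invariantsOf_X₁_eq_top (h : IsSES f g) (hN : ∀ n ∈ N, ∀ y : M₂, ρ₂ n y = y) :
    ρ₁.invariantsOf N = ⊤ :=
  eq_top_iff.2 fun x _ n => h.apply_eq_X₁_of_X₂ hN n n.2 x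

omit [IsTopologicalGroup Γ] [DiscreteTopology M₂] [ContinuousSMul A M₂] [N.Normal] in
/-- The invariants `M₂^N` are everything when `N` acts trivially on `M₂`.
[cite: SerreGaloisCohomology1997, I §2.6] -/
theorem invariantsOf_X₂_eq_top (ρ₂ : ContinuousRep Γ A M₂) (hN : ∀ n ∈ N, ∀ y : M₂, ρ₂ n y = y) :
    ρ₂.invariantsOf N = ⊤ :=
  eq_top_iff.2 fun y _ n => hN n n.2 y

omit [IsTopologicalGroup Γ] [N.Normal] in
/-- The invariants `Mᵢ^N` are everything when `N` acts trivially on `M₂`: for `M₃`.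
[cite: SerreGaloisCohomology1997, I §2.6] -/
theorem invariantsOf_X₃_eq_top (h : IsSES f g) (hN : ∀ n ∈ N, ∀ y : M₂, ρ₂ n y = y) :
    ρ₃.invariantsOf N = ⊤ :=
  eq_top_iff.2 fun v _ n => h.apply_eq_X₃_of_X₂ hN n n.2 v

/-- **The `N`-invariants of a short exact sequence of discrete `Γ`-modules on whose middle term
`N ⊴ Γ` acts trivially form a short exact sequence of discrete `Γ ⧸ N`-modules**
`0 → M₁^N → M₂^N → M₃^N → 0` (`ContinuousRep.quotientInvariants`, maps
`ContinuousRep.invariantsHom`): all three invariant submodules are everything.  (Without the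
hypothesis only `0 → M₁^N → M₂^N → M₃^N` is exact.)  The passage from `Γ_K`-modules unramified
outside `S` to `G_S = Γ_K ⧸ N_S`-modules. [cite: SerreGaloisCohomology1997, I §2.6]
[cite: Harari2020, Def. 15.36 and Remark 17.7 (b)] -/
theorem invariantsHom (h : IsSES f g) (hN : ∀ n ∈ N, ∀ y : M₂, ρ₂ n y = y) :
    IsSES (ContinuousRep.invariantsHom (N := N) f) (ContinuousRep.invariantsHom (N := N) g) where
  comp_eq_zero := by
    ext w
    exact h.g_f_apply (w : M₁)
  injective := fun a b hab =>
    Subtype.ext (h.injective (congrArg (fun w : ρ₂.invariantsOf N => (w : M₂)) hab))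
  exact_mid := fun w hw => by
    have hw' : g.hom (w : M₂) = 0 := congrArg (fun v : ρ₃.invariantsOf N => (v : M₃)) hw
    obtain ⟨x, hx⟩ := h.exact_mid (w : M₂) hw'
    exact ⟨⟨x, fun n => h.apply_eq_X₁_of_X₂ hN n n.2 x⟩, Subtype.ext hx⟩
  surjective := fun v => by
    obtain ⟨y, hy⟩ := h.surjective (v : M₃)
    exact ⟨⟨y, fun n => hN n n.2 y⟩, Subtype.ext hy⟩

end IsSES

end Invariants

/-! ### §3. The Euler-characteristic form of the nine-term count -/

section Euler

variable {A : Type*} [CommRing A] [TopologicalSpace A]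
variable {Γ : Type u} [Group Γ] [TopologicalSpace Γ] [IsTopologicalGroup Γ] [LocallyCompactSpace Γ]
variable {M₁ : Type u} [AddCommGroup M₁] [Module A M₁] [TopologicalSpace M₁] [DiscreteTopology M₁]
  [ContinuousSMul A M₁]
variable {M₂ : Type u} [AddCommGroup M₂] [Module A M₂] [TopologicalSpace M₂] [DiscreteTopology M₂]
  [ContinuousSMul A M₂]
variable {M₃ : Type u} [AddCommGroup M₃] [Module A M₃] [TopologicalSpace M₃] [DiscreteTopology M₃]
  [ContinuousSMul A M₃]
variable {ρ₁ : ContinuousRep Γ A M₁} {ρ₂ : ContinuousRep Γ A M₂} {ρ₃ : ContinuousRep Γ A M₃}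
variable {f : ρ₁.toTopRep ⟶ ρ₂.toTopRep} {g : ρ₂.toTopRep ⟶ ρ₃.toTopRep}

namespace IsSES

/-- **Milne's Lemma 5.3 ("`φ` is multiplicative"), cleared of denominators**: for a short exact
sequence `0 → M₁ → M₂ → M₃ → 0` of finite discrete `Γ`-modules with `H³(Γ, M₁) = 0` and the
`H¹`, `H²` finite, and any exponent `r : ℕ`, writing `χ_r(M) = #M^Γ · #H²(Γ, M) · #M^r` (numerator
of `#H⁰·#H²·#M^r/#H¹`),
`χ_r(M₂) · #H¹(M₁) · #H¹(M₃) = #H¹(M₂) · χ_r(M₁) · χ_r(M₃)`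
(`IsSES.card_nineTerm` and `#M₂ = #M₁·#M₃`).  At a totally complex number field and
`r = r₂(K)` this is the multiplicativity of Tate's `χ(G_S, M)·∏_{v ∣ ∞} |#M|_v`.
[cite: MilneADT2006, I §5 Lemma 5.3 (p. 69) and I §2 Thm. 2.8 (proof)]
[cite: SerreGaloisCohomology1997, II §5.4] -/
theorem card_nineTerm_euler (h : IsSES f g) [Subsingleton (continuousCohomology 3 ρ₁.toTopRep)]
    [Finite M₂] [Finite M₃]
    [Finite (continuousCohomology 1 ρ₁.toTopRep)] [Finite (continuousCohomology 1 ρ₂.toTopRep)]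
    [Finite (continuousCohomology 1 ρ₃.toTopRep)] [Finite (continuousCohomology 2 ρ₁.toTopRep)]
    [Finite (continuousCohomology 2 ρ₂.toTopRep)] (r : ℕ) :
    Nat.card ρ₂.toTopRep.ρ.invariants * Nat.card (continuousCohomology 2 ρ₂.toTopRep) *
          Nat.card M₂ ^ r *
        Nat.card (continuousCohomology 1 ρ₁.toTopRep) * Nat.card (continuousCohomology 1 ρ₃.toTopRep) =
      Nat.card (continuousCohomology 1 ρ₂.toTopRep) *
        (Nat.card ρ₁.toTopRep.ρ.invariants * Nat.card (continuousCohomology 2 ρ₁.toTopRep) *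
          Nat.card M₁ ^ r) *
        (Nat.card ρ₃.toTopRep.ρ.invariants * Nat.card (continuousCohomology 2 ρ₃.toTopRep) *
          Nat.card M₃ ^ r) := by
  have e := h.card_nineTerm
  rw [h.natCard_X₂, mul_pow]
  calc Nat.card ρ₂.toTopRep.ρ.invariants * Nat.card (continuousCohomology 2 ρ₂.toTopRep) *
          (Nat.card M₁ ^ r * Nat.card M₃ ^ r) *
        Nat.card (continuousCohomology 1 ρ₁.toTopRep) * Nat.card (continuousCohomology 1 ρ₃.toTopRep)
        = (Nat.card ρ₂.toTopRep.ρ.invariants * Nat.card (continuousCohomology 1 ρ₁.toTopRep) *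
            Nat.card (continuousCohomology 1 ρ₃.toTopRep) *
            Nat.card (continuousCohomology 2 ρ₂.toTopRep)) * (Nat.card M₁ ^ r * Nat.card M₃ ^ r) := by
          ring
    _ = (Nat.card ρ₁.toTopRep.ρ.invariants * Nat.card ρ₃.toTopRep.ρ.invariants *
            Nat.card (continuousCohomology 1 ρ₂.toTopRep) *
            Nat.card (continuousCohomology 2 ρ₁.toTopRep) *
            Nat.card (continuousCohomology 2 ρ₃.toTopRep)) * (Nat.card M₁ ^ r * Nat.card M₃ ^ r) := by
          rw [e]
    _ = _ := by ring

/-- The same with the `H¹` on the other side — **`χ_r(M₂)·#H¹(M₁)·#H¹(M₃) = χ_r(M₁)·χ_r(M₃)·#H¹(M₂)`**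
regrouped as "`χ(M₂)/#H¹(M₂) = χ(M₁)/#H¹(M₁) · χ(M₃)/#H¹(M₃)`" cleared of denominators:
`(#M₂^Γ·#H²(M₂)·#M₂^r) · (#H¹(M₁)·#H¹(M₃)) = (#M₁^Γ·#H²(M₁)·#M₁^r)·(#M₃^Γ·#H²(M₃)·#M₃^r) · #H¹(M₂)`.
[cite: MilneADT2006, I §5 Lemma 5.3 (p. 69)] -/
theorem card_nineTerm_euler' (h : IsSES f g) [Subsingleton (continuousCohomology 3 ρ₁.toTopRep)]
    [Finite M₂] [Finite M₃]
    [Finite (continuousCohomology 1 ρ₁.toTopRep)] [Finite (continuousCohomology 1 ρ₂.toTopRep)]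
    [Finite (continuousCohomology 1 ρ₃.toTopRep)] [Finite (continuousCohomology 2 ρ₁.toTopRep)]
    [Finite (continuousCohomology 2 ρ₂.toTopRep)] (r : ℕ) :
    Nat.card ρ₂.toTopRep.ρ.invariants * Nat.card (continuousCohomology 2 ρ₂.toTopRep) *
          Nat.card M₂ ^ r *
        (Nat.card (continuousCohomology 1 ρ₁.toTopRep) * Nat.card (continuousCohomology 1 ρ₃.toTopRep)) =
      (Nat.card ρ₁.toTopRep.ρ.invariants * Nat.card (continuousCohomology 2 ρ₁.toTopRep) *
          Nat.card M₁ ^ r) *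
        (Nat.card ρ₃.toTopRep.ρ.invariants * Nat.card (continuousCohomology 2 ρ₃.toTopRep) *
          Nat.card M₃ ^ r) * Nat.card (continuousCohomology 1 ρ₂.toTopRep) := by
  have e := h.card_nineTerm_euler r
  calc _ = Nat.card ρ₂.toTopRep.ρ.invariants * Nat.card (continuousCohomology 2 ρ₂.toTopRep) *
          Nat.card M₂ ^ r *
        Nat.card (continuousCohomology 1 ρ₁.toTopRep) * Nat.card (continuousCohomology 1 ρ₃.toTopRep) := by
          ring
    _ = _ := by rw [e]; ring

end IsSES

end Euler

end Literature.NumberTheory.GaloisRepresentations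

end
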